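import Mathlib
import HarnessLib
import Summits.Langlands.Langlands.Theses.NonParallelVoid
import Literature.NumberTheory.PAdicHodge.FontaineDpst
import Summits.Langlands.Langlands.Theorems.NonParallelVoidEmptyWeightCorePinnedCrystallineDetLocalOfFDE
import Summits.Langlands.Langlands.Theorems.NonParallelVoidEmptyWeightCoreStubSplitPrime
import Summits.Langlands.Langlands.Theorems.NonParallelVoidGapArithmetic
import Summits.Langlands.Langlands.Theorems.NonParallelVoidTensorSquareParallelStubUnramifiedOutsidePVoidCFT
import Literature.NumberTheory.GaloisRepresentations.LAdicCharacterLocalGlobalProofs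
import Literature.NumberTheory.GaloisRepresentations.LAdicCharacterIdelicValuesProofs
import Literature.NumberTheory.GaloisRepresentations.LocalArtinMapPinned
import Literature.NumberTheory.Automorphic.AdicCompletionResidueCard

/-!
# Stub `stub_unramifiedOutsidePVoid` (line `merged`, crux `TensorSquareParallel`, stmt-Langlands-17009)

**Stub 7a: the crux is VOID for `ρ` unramified at every finite place prime to `p`.**  Under the T0 named
fact `FontaineDatumExists`, for `F` imaginary quadratic, `p ≥ 11` split, `ρ : Γ_F → GL₂(ℚ̄_p)` pinned-
crystalline above `p` with labelled Hodge–Tate weights `{a < b}`, a failure of the parity clause (labels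
`(v,τ)`, `(w,σ)` with `(b-a)+(b'-a')` odd) forces `ρ` to ramify at some `𝔮 ∤ p`.

## What the tree's class field theory provides (read 2026-08-17; summary for the lead)

* GLOBAL: `GlobalReciprocity.lean` vends `IsGlobalReciprocityMap`/`exists_isGlobalReciprocityMap` (Neukirch
  III (7.12)), now a THEOREM via `artinReciprocity_character_holds` + `GlobalReciprocityCharacterFormProofs`;
  the consumer-facing form is `FramedGaloisRep.exists_idelicCharacter_localGlobal`
  (`LAdicCharacterLocalGlobalProofs`): for `ψ : Γ_K →ₜ* GL₁(A)` (`A` ultrametric normed field, `K : Type`)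
  an idele character `Ψ : 𝕀_K →ₜ* Aˣ`, trivial on `Kˣ`, killing `𝒪_vˣ` where `ψ` is unramified, and with
  `Ψ(⟨a w⟩_v) = det ψ(res_v w)⁻¹` for EVERY finite `v`, EVERY `a : W_{K_v} →* K_vˣ` with `IsLocalArtinMap`
  and every `w ∈ W_{K_v}` (note the inverse: `Ψ = ψ^ab ∘ ( , K)` with Tate's `ψ_{L|K}`).
* VALUES: `IdelicCharacter.map_infiniteIdeles_mul_prod_localUnits_eq_one` (product formula at a principal
  idele, `LAdicCharacterIdelicValuesProofs`) and `map_infiniteIdeles_sq_eq_one` (`Ψ((x²)_∞) = 1`).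
* LOCAL: `LocalClassFieldTheory.lean`: `IsLocalArtinMap` (Deligne's normalisation: geometric Frobenius ↦
  uniformiser; `image_inertia : art(I) = 𝒪ˣ`; `ker_artin = closure [W,W]`), THE map `canonicalArtin K_v`
  with `isLocalArtinMap_canonicalArtin_holds` (`LocalArtinMapPinned`, unconditional).  The explicit law
  `ε_p ∘ Art = N` on units is only the NAMED FACT `cyclotomicCharacter_artin_eq_norm` (unproved; Lubin–Tate
  reciprocity `coe_lubinTateChar_toAbsGalois` IS proved but not linked to `ε_p`).  We avoid it: the
  companion file `…StubUnramifiedOutsidePVoidCFT` proves `ε_p(x) = -1` for inertia `x` with `art x = -1`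
  at a place with `e = f = 1`, from `stub_modPCyclotomicOnInertia` (`ε̄_p(I) = 𝔽_pˣ`), Hensel and an
  index count — normalisation-free.
* GLUE: `absInertia`/`WeilGroup.inertia` (`mem_inertia_iff`), unramified `⇒` `Ψ(𝒪_vˣ) = 1` is built into
  `exists_idelicCharacter_localGlobal`; `det ρ|I_v = ε^{-(a+b)}` is the EmptyWeightCore helper
  `stub_pinnedCrystallineDetLocal_of_fontaineDatumExists` (clause (F12), under `FontaineDatumExists`).

## Proof

If `v = w` the unique label of the degree-one `F_v` (`algHom_adicCompletion_subsingleton_of_split`) makes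
the two weight pairs equal, so the gap sum is even.  If `v ≠ w`: apply the product formula to the idele
character `Ψ` of `det ρ` at the global unit `-1` with `S = {v, w}` (a third place above `p` would break
`Σ e f = 2`; away from `p`, `ρ` — hence `det ρ` — is unramified by hypothesis): the archimedean factor
dies (`-1 = i²` at every complex place, `F` totally complex), and at `u ∈ {v, w}` the factor is
`det ρ(x_u)⁻¹ = ε_p(x_u)^{a_u+b_u} = (-1)^{a_u+b_u}` for an inertia element `x_u` of `W_{F_u}` over `-1`.
Hence `(-1)^{(a+b)+(a'+b')} = 1`, i.e. the gap sum is even — contradiction.  [folklore]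
No `sorry`, no new definition, no named fact beyond the antecedent `FontaineDatumExists`.
-/

-- project-wide option (lakefile weak.linter.dupNamespace); `Summit.Langlands.Langlands` is mandated
set_option linter.dupNamespace false

noncomputable section

open scoped NumberField Kronecker
open IsDedekindDomain Field
open Literature.NumberTheory.GaloisRepresentations Literature.NumberTheory.PAdicHodge
  Literature.NumberTheory.Automorphic

namespace Summit.Langlands.Langlands.Theorems.TensorSquareParallel

open NumberField ValuativeRel
open Literature.NumberTheory.GaloisRepresentations.IsNonarchimedeanLocalField (residueFieldCard)
open Summit.Langlands.Langlands.Cruxes.EmptyWeightCore.LocalClauseCut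
  (stub_splitPrime splitPrime_liesOver_span stub_pinnedCrystallineDetLocal_of_fontaineDatumExists)

section Helpers

/-- **A quadratic field has at most two places above a rational prime**: if `v ≠ w` both lie above `p`
then every place above `p` is `v` or `w` (`Σ_{q ∣ p} e_q f_q = [F : ℚ] = 2`, Mathlib
`Ideal.sum_ramification_inertia_eq_finrank`, has at most two positive summands).
[cite: NeukirchANT1999, Ch. I §8 Prop. (8.2)] -/
theorem eq_or_eq_of_natCast_mem_of_ne {F : Type} [Field F] [NumberField F]
    [Algebra.IsQuadraticExtension ℚ F] (p : ℕ) [Fact p.Prime] {v w : HeightOneSpectrum (𝓞 F)}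
    (hvw : v ≠ w) (hv : ((p : ℕ) : 𝓞 F) ∈ v.asIdeal) (hw : ((p : ℕ) : 𝓞 F) ∈ w.asIdeal)
    (u : HeightOneSpectrum (𝓞 F)) (hu : ((p : ℕ) : 𝓞 F) ∈ u.asIdeal) : u = v ∨ u = w := by
  classical
  by_contra h
  push Not at h
  set P : Ideal ℤ := Ideal.span {(p : ℤ)}
  have hsum := Ideal.sum_ramification_inertia_eq_finrank P (𝓞 F)
  rw [RingOfIntegers.rank, Algebra.IsQuadraticExtension.finrank_eq_two ℚ F] at hsum
  have hmem : ∀ {q : HeightOneSpectrum (𝓞 F)}, ((p : ℕ) : 𝓞 F) ∈ q.asIdeal →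
      q.asIdeal ∈ P.primesOver (𝓞 F) :=
    fun hq => ⟨inferInstance, splitPrime_liesOver_span p hq⟩
  have hf1 : ∀ q : P.primesOver (𝓞 F), 1 ≤ q.1.ramificationIdx ℤ * q.1.inertiaDeg ℤ := fun q => by
    haveI : q.1.IsPrime := q.2.1
    exact Nat.one_le_iff_ne_zero.2 (Nat.mul_ne_zero (Ideal.ramificationIdx_pos q.1 ℤ).ne'
      (Ideal.inertiaDeg_pos q.1 ℤ).ne')
  set f : P.primesOver (𝓞 F) → ℕ := fun q => q.1.ramificationIdx ℤ * q.1.inertiaDeg ℤ with hf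
  let a : P.primesOver (𝓞 F) := ⟨v.asIdeal, hmem hv⟩
  let b : P.primesOver (𝓞 F) := ⟨w.asIdeal, hmem hw⟩
  let c : P.primesOver (𝓞 F) := ⟨u.asIdeal, hmem hu⟩
  have hab : a ≠ b := fun h' => hvw (HeightOneSpectrum.ext (congrArg Subtype.val h'))
  have hca : c ≠ a := fun h' => h.1 (HeightOneSpectrum.ext (congrArg Subtype.val h'))
  have hcb : c ≠ b := fun h' => h.2 (HeightOneSpectrum.ext (congrArg Subtype.val h'))
  have hle : f c + (f a + f b) ≤ 2 :=
    calc f c + (f a + f b) = ∑ q ∈ ({c, a, b} : Finset (P.primesOver (𝓞 F))), f q := by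
          rw [Finset.sum_insert (by simp [hca, hcb]), Finset.sum_pair hab]
      _ ≤ ∑ q : P.primesOver (𝓞 F), f q := Finset.sum_le_sum_of_subset (Finset.subset_univ _)
      _ = 2 := hsum
  have h1 := hf1 a; have h2 := hf1 b; have h3 := hf1 c
  simp only [hf] at hle
  omega

/-- In a totally complex number field `-1` is a square in `(F ⊗ ℝ)ˣ = ∏_{w ∣ ∞} ℂˣ`. [folklore] -/
theorem exists_sq_eq_neg_one_infiniteAdeleRing {F : Type*} [Field F] [NumberField F]
    (hF : NumberField.IsTotallyComplex F) : ∃ x : (InfiniteAdeleRing F)ˣ, x ^ 2 = -1 := by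
  let i : InfiniteAdeleRing F := fun w =>
    (InfinitePlace.Completion.ringEquivComplexOfIsComplex (hF.isComplex w)).symm Complex.I
  have hi : i * i = -1 := by
    funext w
    change i w * i w = -1
    simp only [i]
    rw [← map_mul, Complex.I_mul_I, map_neg, map_one]
  refine ⟨⟨i, -i, by rw [mul_neg, hi, neg_neg], by rw [neg_mul, hi, neg_neg]⟩, Units.ext ?_⟩
  rw [Units.val_pow_eq_pow_val, Units.val_neg, Units.val_one, sq]
  exact hi

/-- The determinant of the rank-one framed representation attached to a character is that character.
[folklore] -/
theorem det_unitsContinuousMulEquivOfUnique_comp {G : Type*} [Group G] [TopologicalSpace G]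
    {A : Type*} [CommRing A] [TopologicalSpace A] [IsTopologicalRing A] (χ : G →ₜ* Aˣ) (g : G) :
    FramedRep.det ((FramedRep.unitsContinuousMulEquivOfUnique (Fin 1) A : Aˣ →ₜ* GL (Fin 1) A).comp χ)
      g = χ g := by
  ext
  simp [Matrix.det_unique]

end Helpers

/-- **stub 7a — the crux `TensorSquareParallel` is VOID for `ρ` unramified away from `p`** (crux idea
`odd-central-character-ramification`).  Under `FontaineDatumExists`: `F` imaginary quadratic (quadratic and
totally complex), `p ≥ 11` split, `ρ : Γ_F → GL₂(ℚ̄_p)` pinned-crystalline above `p` with labelled weights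
`{a < b}`, and NOT every pair of labels has even gap sum ⟹ `ρ` is NOT unramified at every finite place
prime to `p`.  Odd gap sum `⇒` odd weight sum of `det ρ` at the two split places; `det ρ|I_u = ε^{-(a+b)}`
(clause (F12), `stub_pinnedCrystallineDetLocal_of_fontaineDatumExists`); the product formula for the idele
character of `det ρ` (`FramedGaloisRep.exists_idelicCharacter_localGlobal`, Tate's global reciprocity, a
theorem of the tree) at the unit `-1`: archimedean factor `1` (`F` totally complex), unramified factors
`1`, and `ε_p(art⁻¹(-1)) = -1` at `v`, `w` (`cyclotomicCharacter_toAbsGalois_eq_neg_one_of_artin_eq_neg_one`)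
give `(-1)^{(a+b)+(a'+b')} = 1` — contradiction.
[cite: CasselsFrohlichANT1967, Ch. VII §5–§6 (Tate, global reciprocity)] [cite: SerreLCFT1967, §3.1 Thm. 2]
[folklore] -/
theorem stub_unramifiedOutsidePVoid :
    FontaineDatumExists → ∀ (F : Type) [Field F] [NumberField F] [Algebra.IsQuadraticExtension ℚ F], NumberField.IsTotallyComplex F → ∀ (p : ℕ) [Fact p.Prime] (ρ : FramedGaloisRep F (PadicAlgCl p) 2), (∀ (v : HeightOneSpectrum (𝓞 F)) (hv : ((p : ℕ) : 𝓞 F) ∈ v.asIdeal), (fontainePstAdicCompletion v p hv).IsDeRhamFramed (ρ.toLocal v) ∧ (letI := (fontainePstAdicCompletion v p hv).algebra; ∀ τ : v.adicCompletion F →ₐ[ℚ_[p]] PadicAlgCl p, ∃ a b : ℤ, a < b ∧ ρ.labelledHodgeTateWeightsAt v (fontainePstAdicCompletion v p hv).algebra (fontainePstAdicCompletion v p hv).𝔅 τ.toRingHom = {a, b})) → (11 ≤ p ∧ (∃ v w : HeightOneSpectrum (𝓞 F), v ≠ w ∧ ((p : ℕ) : 𝓞 F) ∈ v.asIdeal ∧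 ((p : ℕ) : 𝓞 F) ∈ w.asIdeal) ∧ (∀ (v : HeightOneSpectrum (𝓞 F)) (hv : ((p : ℕ) : 𝓞 F) ∈ v.asIdeal), (fontainePstAdicCompletion v p hv).IsCrystallineFramed (ρ.toLocal v)) ∧ FramedGaloisRep.IsResiduallyAbsIrreducible (ρ.restrictField (CyclotomicField p F))) → ¬ (∀ (v : HeightOneSpectrum (𝓞 F)) (hv : ((p : ℕ) : 𝓞 F) ∈ v.asIdeal) (w : HeightOneSpectrum (𝓞 F)) (hw : ((p : ℕ) : 𝓞 F) ∈ w.asIdeal), letI := (fontainePstAdicCompletion v p hv).algebra; letI := (fontainePstAdicCompletion w p hw).algebra; ∀ (τ : v.adicCompletion F →ₐ[ℚ_[p]] PadicAlgCl p) (σ : w.adicCompletion F →ₐ[ℚ_[p]] PadicAlgCl p) (a b a' b' : ℤ), ρ.labelledHodgeTateWeightsAt v (fontainePstAdicCompletion v p hv).algebra (fontainePstAdicCompletion v p hv).𝔅 τ.toRingHom = {a, b} → a < b → ρ.labelledHodgeTateWeightsAt w (fontainePstAdicCompletion w p hw).algebra (fontainePstAdicCompletion w p hw).𝔅 σ.toRingHom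 = {a', b'} → a' < b' → Even (b - a + (b' - a'))) → ¬ (∀ v : HeightOneSpectrum (𝓞 F), ((p : ℕ) : 𝓞 F) ∉ v.asIdeal → ρ.IsUnramifiedAt v) := by
  intro hFD F _ _ _ hF p _ ρ _hHT hG hE hU
  classical
  obtain ⟨hp11, hsplit, hcrys, -⟩ := hG
  have hp2 : p ≠ 2 := by omega
  -- two labels with odd gap sum, from the failure of the parity clause
  have hNP : ∃ (v : HeightOneSpectrum (𝓞 F)) (hv : ((p : ℕ) : 𝓞 F) ∈ v.asIdeal) (w : HeightOneSpectrum (𝓞 F)) (hw : ((p : ℕ) : 𝓞 F) ∈ w.asIdeal), letI := (fontainePstAdicCompletion v p hv).algebra; letI := (fontainePstAdicCompletion w p hw).algebra; ∃ (τ : v.adicCompletion F →ₐ[ℚ_[p]] PadicAlgCl p) (σ : w.adicCompletion F →ₐ[ℚ_[p]] PadicAlgCl p) (a b a' b' : ℤ), ρ.labelledHodgeTateWeightsAt v (fontainePstAdicCompletion v p hv).algebra (fontainePstAdicCompletion v p hv).𝔅 τ.toRingHom = {a, b} ∧ a < b ∧ ρ.labelledHodgeTateWeightsAt w (fontainePstAdicCompletion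 w p hw).algebra (fontainePstAdicCompletion w p hw).𝔅 σ.toRingHom = {a', b'} ∧ a' < b' ∧ ¬ Even (b - a + (b' - a')) := by
    by_contra hcon
    apply hE
    intro v hv w hw τ σ a b a' b' h1 h2 h3 h4
    by_contra hodd
    exact hcon ⟨v, hv, w, hw, τ, σ, a, b, a', b', h1, h2, h3, h4, hodd⟩
  obtain ⟨v₀, hv₀, w₀, hw₀, τ, σ, a, b, a', b', hab, hlt, hab', hlt', hodd⟩ := hNP
  have hSv := stub_splitPrime F p hsplit v₀ hv₀
  by_cases hvw : v₀ = w₀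
  · -- ONE place: the label of the degree-one field `F_v` is unique, so the two pairs coincide
    subst hvw
    have hsub : @Subsingleton (letI := (fontainePstAdicCompletion v₀ p hv₀).algebra;
        v₀.adicCompletion F →ₐ[ℚ_[p]] PadicAlgCl p) := by
      rw [fontainePstAdicCompletion_algebra_eq_adicCompletionPadicAlgebra v₀ p hv₀]
      exact Summit.Langlands.Langlands.Theorems.LiftB2CrysSplitP.algHom_adicCompletion_subsingleton_of_split
        v₀ p hv₀ hSv.1 hSv.2.1 _
    have hτσ : τ = σ := Subsingleton.elim _ _
    subst hτσ
    rw [hab] at hab'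
    rcases Summit.Langlands.Langlands.Theorems.NonParallelVoid.pair_eq_pair_iff.1 hab' with ⟨h1, h2⟩ | ⟨h1, h2⟩
    · exact hodd ⟨b - a, by omega⟩
    · omega
  · -- TWO places: the idele character of `det ρ` at the global unit `-1`
    -- `det ρ` as a rank-one framed representation
    set ψ : FramedGaloisRep F (PadicAlgCl p) 1 :=
      (FramedRep.unitsContinuousMulEquivOfUnique (Fin 1) (PadicAlgCl p) :
          (PadicAlgCl p)ˣ →ₜ* GL (Fin 1) (PadicAlgCl p)).comp (FramedRep.det ρ) with hψ
    have hψdet : ∀ g, FramedRep.det ψ g = FramedRep.det ρ g := fun g =>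
      det_unitsContinuousMulEquivOfUnique_comp (FramedRep.det ρ) g
    have hψunr : ∀ v, ρ.IsUnramifiedAt v → ψ.IsUnramifiedAt v := by
      intro v hv 𝔓 h𝔓 s hs
      change (FramedRep.unitsContinuousMulEquivOfUnique (Fin 1) (PadicAlgCl p) :
          (PadicAlgCl p)ˣ →ₜ* GL (Fin 1) (PadicAlgCl p)) (FramedRep.det ρ s) = 1
      rw [FramedRep.det_apply, hv 𝔓 h𝔓 s hs, map_one, map_one]
    obtain ⟨Ψ, hΨK, hΨunr, hΨloc⟩ := FramedGaloisRep.exists_idelicCharacter_localGlobal ψ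
    -- product formula at `-1` with `S = {v₀, w₀}`
    have hprod := IdelicCharacter.map_infiniteIdeles_mul_prod_localUnits_eq_one Ψ hΨK
      (S := ({v₀, w₀} : Finset (HeightOneSpectrum (𝓞 F)))) ?_ (-1) ?_
    rotate_left
    · intro u hu uu
      have hpu : ((p : ℕ) : 𝓞 F) ∉ u.asIdeal := by
        intro hpu
        rcases eq_or_eq_of_natCast_mem_of_ne p hvw hv₀ hw₀ u hpu with rfl | rfl
        · exact hu (Finset.mem_insert_self _ _)
        · exact hu (Finset.mem_insert_of_mem (Finset.mem_singleton_self _))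
      exact (hΨunr u (hψunr u (hU u hpu))).1 uu
    · intro u _
      rw [Units.val_neg, Units.val_one, Valuation.map_neg, map_one]
    rw [Finset.prod_pair hvw] at hprod
    -- the archimedean factor dies: `-1 = i²` at every (complex) infinite place
    have hinf : Ψ (infiniteIdeles F (globalToInfiniteUnits F (-1))) = 1 := by
      obtain ⟨x, hx⟩ := exists_sq_eq_neg_one_infiniteAdeleRing hF
      have h1 : globalToInfiniteUnits F (-1) = x ^ 2 := by
        rw [hx]
        apply Units.ext
        rw [val_globalToInfiniteUnits, Units.val_neg, Units.val_one, map_neg, map_one, Units.val_neg,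
          Units.val_one]
      rw [h1]
      exact IdelicCharacter.map_infiniteIdeles_sq_eq_one Ψ x
    rw [hinf, one_mul] at hprod
    -- the local factor at a place `u ∣ p` with label `κ` and weights `{c, d}` is `(-1)^{c+d}`
    have hloc : ∀ (u : HeightOneSpectrum (𝓞 F)) (hu : ((p : ℕ) : 𝓞 F) ∈ u.asIdeal),
        letI := (fontainePstAdicCompletion u p hu).algebra
        ∀ (κ : u.adicCompletion F →ₐ[ℚ_[p]] PadicAlgCl p) (c d : ℤ),
          ρ.labelledHodgeTateWeightsAt u (fontainePstAdicCompletion u p hu).algebra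
              (fontainePstAdicCompletion u p hu).𝔅 κ.toRingHom = {c, d} →
          ((Ψ (localUnits u (globalToLocalUnits u (-1))) : (PadicAlgCl p)ˣ) : PadicAlgCl p) =
            (-1 : PadicAlgCl p) ^ (c + d) := by
      intro u hu κ c d hcd
      haveI := LocalField.charZero_adicCompletion u
      have hSu := stub_splitPrime F p hsplit u hu
      have hqu : residueFieldCard (u.adicCompletion F) = p := by
        rw [residueFieldCard_adicCompletion_eq]; exact hSu.1
      -- THE local Artin map of `F_u` and an inertia element over `-1`
      have hart := isLocalArtinMap_canonicalArtin_holds (u.adicCompletion F)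
      have hmem : (-1 : (u.adicCompletion F)ˣ) ∈
          (WeilGroup.inertia (u.adicCompletion F)).map (canonicalArtin (u.adicCompletion F)) := by
        rw [hart.image_inertia, Valuation.mem_unitGroup_iff, Units.val_neg, Units.val_one,
          Valuation.map_neg, map_one]
      obtain ⟨x, hxI, hx⟩ := Subgroup.mem_map.mp hmem
      have hεx := cyclotomicCharacter_toAbsGalois_eq_neg_one_of_artin_eq_neg_one p hp2 hqu hSu.2.2 hart
        hxI hx
      -- local–global compatibility of `Ψ` at `u`
      have h1 := hΨloc u (canonicalArtin _) hart x
      rw [hx] at h1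
      have hneg : globalToLocalUnits u (-1 : Fˣ) = -1 := by
        apply Units.ext
        rw [val_globalToLocalUnits, Units.val_neg, Units.val_one, map_neg, map_one, Units.val_neg,
          Units.val_one]
      rw [hneg, h1, hψdet, Units.val_inv_eq_inv_val]
      -- the pinned determinant on inertia
      have hσI : WeilGroup.toAbsGalois _ x ∈ absInertia (u.adicCompletion F) :=
        WeilGroup.mem_inertia_iff.mp hxI
      have hdet := stub_pinnedCrystallineDetLocal_of_fontaineDatumExists hFD F p ρ hsplit u hu (hcrys u hu)
        κ c d hcd _ hσI
      rw [hεx] at hdet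
      have hval : ((FramedRep.det ρ (absGaloisRestrict F (u.adicCompletion F)
            (WeilGroup.toAbsGalois _ x)) : (PadicAlgCl p)ˣ) : PadicAlgCl p) =
          (-1 : PadicAlgCl p) ^ (-(c + d)) := by
        rw [FramedRep.det_apply, Matrix.GeneralLinearGroup.val_det_apply]
        change ((ρ.toLocal u) (WeilGroup.toAbsGalois _ x)).val.det = _
        rw [hdet, Units.val_neg, Units.val_one, PadicInt.coe_neg, PadicInt.coe_one, map_zpow₀, map_neg,
          map_one]
      rw [hval, ← zpow_neg, neg_neg]
    -- at `v₀` and `w₀`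
    have e1 := hloc v₀ hv₀ τ a b hab
    have e2 := hloc w₀ hw₀ σ a' b' hab'
    have hfin : (-1 : PadicAlgCl p) ^ (a + b) * (-1) ^ (a' + b') = 1 := by
      rw [← e1, ← e2, ← Units.val_mul, hprod, Units.val_one]
    rw [← zpow_add₀ (neg_ne_zero.mpr (one_ne_zero' (PadicAlgCl p)))] at hfin
    have heven : Even (a + b + (a' + b')) := by
      by_contra hne
      rw [Int.not_even_iff_odd] at hne
      rw [hne.neg_one_zpow] at hfin
      have h2 : (2 : PadicAlgCl p) = 0 := by linear_combination -hfin
      exact two_ne_zero h2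
    apply hodd
    obtain ⟨r, hr⟩ := heven
    exact ⟨r - a - a', by omega⟩

end Summit.Langlands.Langlands.Theorems.TensorSquareParallel

end
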